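import Mathlib.Analysis.Fourier.FiniteAbelian.PontryaginDuality
import Mathlib.Tactic.Linarith
import Mathlib.Tactic.LinearCombination
import Mathlib.Tactic.Ring
import Mathlib.Tactic.Positivity
import Literature.Combinatorics.Additive.TripleProductProperty
import Summits.MatrixMultiplication.OmegaCensus.DihedralLikeTPPBound
import Summits.MatrixMultiplication.OmegaCensus.DihedralLawComplete
import HarnessLib

/-!
# Character sums over a finite abelian group and the double-tiling obstruction for dihedral-like groups

ω-census, family (b3).  Framing: lottery ticket; floor = certified bounds/negative ranges.

General-`A` versions (any finite abelian group `A`, additive characters `AddChar A ℂ`) of the finite-Fourier lemmas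
of `DihedralLawComplete.lean` (`parseval_charsum'`, `charsum_sumset'`, `charsum_tiling'`), the four counting
constraints on the coset parts of a TPP triple in a group with a dihedral-like presentation over `A`
(`parts_counting'`), and the obstruction `three_dvd_of_double_tiling'`: if both sumset triangles tile `A` with all
six parts non-empty then `3 ∣ |A|`.  Consumed by `DihedralLikeLaw.lean` (`β(G) ≤ 4⌊|G|/3⌋` on the whole
generalized dihedral / dicyclic class).
-/

namespace Summit.MatrixMultiplication.OmegaCensus

open Literature.Combinatorics.Additive Finset

/-! ## Character sums on a finite abelian group -/

section Fourier

variable {A : Type*} [AddCommGroup A] [Fintype A] [DecidableEq A]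

omit [DecidableEq A] in
/-- `conj (∑_{a∈X} ψ a) = ∑_{a∈X} ψ(−a)`. [folklore] -/
theorem conj_charsum' (ψ : AddChar A ℂ) (X : Finset A) :
    (starRingEnd ℂ) (∑ a ∈ X, ψ a) = ∑ a ∈ X, ψ (-a) := by
  rw [map_sum]
  exact Finset.sum_congr rfl fun a _ => (AddChar.map_neg_eq_conj ψ a).symm

/-- Parseval, `ℂ`-form: `∑_ψ (∑_{a∈X} ψ a)(∑_{a∈X} ψ(−a)) = |A| |X|`. [folklore] -/
theorem parseval_charsum_mul' (X : Finset A) :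
    ∑ ψ : AddChar A ℂ, (∑ a ∈ X, ψ a) * (∑ a ∈ X, ψ (-a)) = (Fintype.card A : ℂ) * X.card := by
  have step : ∀ ψ : AddChar A ℂ,
      (∑ a ∈ X, ψ a) * (∑ a ∈ X, ψ (-a)) = ∑ a ∈ X, ∑ a' ∈ X, ψ (a + -a') := by
    intro ψ
    rw [Finset.sum_mul_sum]
    refine Finset.sum_congr rfl fun a _ => Finset.sum_congr rfl fun a' _ => ?_
    rw [AddChar.map_add_eq_mul]
  simp_rw [step]
  rw [Finset.sum_comm]
  have inner : ∀ a ∈ X, ∑ ψ : AddChar A ℂ, ∑ a' ∈ X, ψ (a + -a') = (Fintype.card A : ℂ) := by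
    intro a ha
    rw [Finset.sum_comm]
    simp_rw [AddChar.sum_apply_eq_ite, add_neg_eq_zero]
    rw [Finset.sum_ite_eq]
    simp [ha]
  rw [Finset.sum_congr rfl inner, Finset.sum_const, nsmul_eq_mul, mul_comm]

/-- Parseval: `∑_ψ ‖∑_{a∈X} ψ a‖² = |A| |X|`. [folklore] -/
theorem parseval_charsum' (X : Finset A) :
    ∑ ψ : AddChar A ℂ, ‖∑ a ∈ X, ψ a‖ ^ 2 = (Fintype.card A : ℝ) * X.card := by
  have h := parseval_charsum_mul' X
  have key : ∀ ψ : AddChar A ℂ,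
      (∑ a ∈ X, ψ a) * (∑ a ∈ X, ψ (-a)) = ((‖∑ a ∈ X, ψ a‖ ^ 2 : ℝ) : ℂ) := by
    intro ψ
    rw [← conj_charsum', Complex.mul_conj, Complex.normSq_eq_norm_sq, Complex.ofReal_pow]
  simp_rw [key] at h
  exact_mod_cast h

omit [Fintype A] in
/-- The character sum of an injective sumset factorises. [folklore] -/
theorem charsum_sumset' (ψ : AddChar A ℂ) {X Y Z : Finset A}
    (hinj : Set.InjOn (fun p : A × A × A => p.1 + p.2.1 + p.2.2) ↑(X ×ˢ Y ×ˢ Z)) :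
    ∑ x ∈ (X ×ˢ Y ×ˢ Z).image (fun p : A × A × A => p.1 + p.2.1 + p.2.2), ψ x =
      (∑ a ∈ X, ψ a) * (∑ b ∈ Y, ψ b) * (∑ c ∈ Z, ψ c) := by
  rw [Finset.sum_image hinj, Finset.sum_product_right, Finset.sum_product_right]
  simp only [AddChar.map_add_eq_mul, Finset.sum_mul, Finset.mul_sum]

/-- Three pairwise disjoint subsets of total size `|A|` tile `A`, so their character sums cancel at every
non-trivial character. [folklore] -/
theorem charsum_tiling' (ψ : AddChar A ℂ) (hψ : ψ ≠ 0) {P Q R : Finset A}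
    (hPQ : Disjoint P Q) (hPR : Disjoint P R) (hQR : Disjoint Q R)
    (hcard : P.card + Q.card + R.card = Fintype.card A) :
    (∑ x ∈ P, ψ x) + (∑ x ∈ Q, ψ x) + (∑ x ∈ R, ψ x) = 0 := by
  have hunion : P ∪ Q ∪ R = univ := by
    apply Finset.eq_univ_of_card
    rw [card_union_of_disjoint (disjoint_union_left.2 ⟨hPR, hQR⟩), card_union_of_disjoint hPQ, hcard]
  have htot : ∑ x ∈ P ∪ Q ∪ R, ψ x = 0 := by
    rw [hunion]
    exact AddChar.sum_eq_zero_iff_ne_zero.mpr hψ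
  rwa [sum_union (disjoint_union_left.2 ⟨hPR, hQR⟩), sum_union hPQ] at htot

end Fourier

/-! ## The counting constraints and the double-tiling obstruction for a dihedral-like presentation -/

section DihedralLike

variable {A : Type*} [AddCommGroup A] [DecidableEq A] [Fintype A] {G : Type} [Group G] [DecidableEq G]
  {ρ τ : A → G} {c₀ : A} {S T U : Finset G}

/-- The four counting constraints on the coset parts of a TPP triple (abstract version of
`dihedral_parts_counting`). [folklore] -/
theorem parts_counting' (hρρ : ∀ a b, ρ a * ρ b = ρ (a + b)) (hρτ : ∀ a b, ρ a * τ b = τ (b - a))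
    (hτρ : ∀ a b, τ a * ρ b = τ (a + b)) (hττ : ∀ a b, τ a * τ b = ρ (c₀ + b - a))
    (hρ : Function.Injective ρ) (hτ : Function.Injective τ) (hne : ∀ a b, ρ a ≠ τ b)
    (h : TripleProductProperty S T U) :
    (univ.filter fun a : A => ρ a ∈ S).card * (univ.filter fun a : A => ρ a ∈ T).card *
        (univ.filter fun a : A => ρ a ∈ U).card ≤ Fintype.card A ∧
    (univ.filter fun a : A => τ a ∈ S).card * (univ.filter fun a : A => τ a ∈ T).card *
        (univ.filter fun a : A => τ a ∈ U).card ≤ Fintype.card A ∧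
    (univ.filter fun a : A => τ a ∈ S).card * (univ.filter fun a : A => ρ a ∈ T).card *
        (univ.filter fun a : A => ρ a ∈ U).card +
      (univ.filter fun a : A => ρ a ∈ S).card * (univ.filter fun a : A => τ a ∈ T).card *
        (univ.filter fun a : A => ρ a ∈ U).card +
      (univ.filter fun a : A => ρ a ∈ S).card * (univ.filter fun a : A => ρ a ∈ T).card *
        (univ.filter fun a : A => τ a ∈ U).card ≤ Fintype.card A ∧
    (univ.filter fun a : A => ρ a ∈ S).card * (univ.filter fun a : A => τ a ∈ T).card *
        (univ.filter fun a : A => τ a ∈ U).card +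
      (univ.filter fun a : A => τ a ∈ S).card * (univ.filter fun a : A => ρ a ∈ T).card *
        (univ.filter fun a : A => τ a ∈ U).card +
      (univ.filter fun a : A => τ a ∈ S).card * (univ.filter fun a : A => τ a ∈ T).card *
        (univ.filter fun a : A => ρ a ∈ U).card ≤ Fintype.card A := by
  set S₀ : Finset A := univ.filter fun a => ρ a ∈ S with hS₀
  set S₁ : Finset A := univ.filter fun a => τ a ∈ S with hS₁
  set T₀ : Finset A := univ.filter fun a => ρ a ∈ T with hT₀
  set T₁ : Finset A := univ.filter fun a => τ a ∈ T with hT₁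
  set U₀ : Finset A := univ.filter fun a => ρ a ∈ U with hU₀
  set U₁ : Finset A := univ.filter fun a => τ a ∈ U with hU₁
  have mS₀ : ∀ a ∈ S₀, cond false (τ a) (ρ a) ∈ S := fun a ha => by simpa [hS₀] using ha
  have mS₁ : ∀ a ∈ S₁, cond true (τ a) (ρ a) ∈ S := fun a ha => by simpa [hS₁] using ha
  have mT₀ : ∀ a ∈ T₀, cond false (τ a) (ρ a) ∈ T := fun a ha => by simpa [hT₀] using ha
  have mT₁ : ∀ a ∈ T₁, cond true (τ a) (ρ a) ∈ T := fun a ha => by simpa [hT₁] using ha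
  have mU₀ : ∀ a ∈ U₀, cond false (τ a) (ρ a) ∈ U := fun a ha => by simpa [hU₀] using ha
  have mU₁ : ∀ a ∈ U₁, cond true (τ a) (ρ a) ∈ U := fun a ha => by simpa [hU₁] using ha
  have hn : ∀ X : Finset A, X.card ≤ Fintype.card A := fun X => card_le_univ X
  have cs := card_sumset' hρρ hττ hρ hτ h
  have d₁ := disjoint_sumset₁' hρρ hρτ hτρ hττ hne h
  have d₂ := disjoint_sumset₂' hρρ hρτ hτρ hττ hne h
  have d₃ := disjoint_sumset₃' hρρ hρτ hτρ hττ hne h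
  refine ⟨?_, ?_, ?_, ?_⟩
  · rw [← cs false false false mS₀ mT₀ mU₀]; exact hn _
  · rw [← cs true true true mS₁ mT₁ mU₁]; exact hn _
  · rw [← cs true false false mS₁ mT₀ mU₀, ← cs false true false mS₀ mT₁ mU₀, ← cs false false true mS₀ mT₀ mU₁,
      ← card_union_of_disjoint (d₁ false mS₁ mT₀ mU₀ mS₀ mT₁),
      ← card_union_of_disjoint (disjoint_union_left.2
        ⟨(d₃ false mS₀ mT₀ mU₁ mS₁ mU₀).symm, d₂ false mS₀ mT₁ mU₀ mS₀ mT₀ mU₁⟩)]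
    exact hn _
  · rw [← cs false true true mS₀ mT₁ mU₁, ← cs true false true mS₁ mT₀ mU₁, ← cs true true false mS₁ mT₁ mU₀,
      ← card_union_of_disjoint (d₁ true mS₁ mT₀ mU₁ mS₀ mT₁).symm,
      ← card_union_of_disjoint (disjoint_union_left.2
        ⟨d₃ true mS₀ mT₁ mU₁ mS₁ mU₀, (d₂ true mS₁ mT₁ mU₀ mS₁ mT₀ mU₁).symm⟩)]
    exact hn _

/-- **No double tiling** (abstract): if both sumset triangles of a TPP triple tile `A` and all six coset parts are
non-empty then `3 ∣ |A|`. [folklore] -/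
theorem three_dvd_of_double_tiling' (hρρ : ∀ a b, ρ a * ρ b = ρ (a + b)) (hρτ : ∀ a b, ρ a * τ b = τ (b - a))
    (hτρ : ∀ a b, τ a * ρ b = τ (a + b)) (hττ : ∀ a b, τ a * τ b = ρ (c₀ + b - a))
    (hρ : Function.Injective ρ) (hτ : Function.Injective τ) (hne : ∀ a b, ρ a ≠ τ b)
    (h : TripleProductProperty S T U)
    (hs₀ : (univ.filter fun a : A => ρ a ∈ S).Nonempty) (hs₁ : (univ.filter fun a : A => τ a ∈ S).Nonempty)
    (ht₀ : (univ.filter fun a : A => ρ a ∈ T).Nonempty) (ht₁ : (univ.filter fun a : A => τ a ∈ T).Nonempty)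
    (hu₀ : (univ.filter fun a : A => ρ a ∈ U).Nonempty) (hu₁ : (univ.filter fun a : A => τ a ∈ U).Nonempty)
    (hA₁ : (univ.filter fun a : A => τ a ∈ S).card * (univ.filter fun a : A => ρ a ∈ T).card *
        (univ.filter fun a : A => ρ a ∈ U).card +
      (univ.filter fun a : A => ρ a ∈ S).card * (univ.filter fun a : A => τ a ∈ T).card *
        (univ.filter fun a : A => ρ a ∈ U).card +
      (univ.filter fun a : A => ρ a ∈ S).card * (univ.filter fun a : A => ρ a ∈ T).card *
        (univ.filter fun a : A => τ a ∈ U).card = Fintype.card A)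
    (hA₂ : (univ.filter fun a : A => ρ a ∈ S).card * (univ.filter fun a : A => τ a ∈ T).card *
        (univ.filter fun a : A => τ a ∈ U).card +
      (univ.filter fun a : A => τ a ∈ S).card * (univ.filter fun a : A => ρ a ∈ T).card *
        (univ.filter fun a : A => τ a ∈ U).card +
      (univ.filter fun a : A => τ a ∈ S).card * (univ.filter fun a : A => τ a ∈ T).card *
        (univ.filter fun a : A => ρ a ∈ U).card = Fintype.card A) : 3 ∣ Fintype.card A := by
  set S₀ : Finset A := univ.filter fun a => ρ a ∈ S with hS₀
  set S₁ : Finset A := univ.filter fun a => τ a ∈ S with hS₁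
  set T₀ : Finset A := univ.filter fun a => ρ a ∈ T with hT₀
  set T₁ : Finset A := univ.filter fun a => τ a ∈ T with hT₁
  set U₀ : Finset A := univ.filter fun a => ρ a ∈ U with hU₀
  set U₁ : Finset A := univ.filter fun a => τ a ∈ U with hU₁
  have mS₀ : ∀ a ∈ S₀, cond false (τ a) (ρ a) ∈ S := fun a ha => by simpa [hS₀] using ha
  have mS₁ : ∀ a ∈ S₁, cond true (τ a) (ρ a) ∈ S := fun a ha => by simpa [hS₁] using ha
  have mT₀ : ∀ a ∈ T₀, cond false (τ a) (ρ a) ∈ T := fun a ha => by simpa [hT₀] using ha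
  have mT₁ : ∀ a ∈ T₁, cond true (τ a) (ρ a) ∈ T := fun a ha => by simpa [hT₁] using ha
  have mU₀ : ∀ a ∈ U₀, cond false (τ a) (ρ a) ∈ U := fun a ha => by simpa [hU₀] using ha
  have mU₁ : ∀ a ∈ U₁, cond true (τ a) (ρ a) ∈ U := fun a ha => by simpa [hU₁] using ha
  obtain ⟨F, hF⟩ : ∃ F : Finset A → AddChar A ℂ → ℂ, ∀ X ψ, F X ψ = ∑ a ∈ X, ψ a := ⟨_, fun _ _ => rfl⟩
  obtain ⟨sig, hsig⟩ : ∃ sig : Finset A → Finset A → Finset A → Finset A,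
      ∀ X Y Z, sig X Y Z = (X ×ˢ Y ×ˢ Z).image fun p : A × A × A => p.1 + p.2.1 + p.2.2 :=
    ⟨_, fun _ _ _ => rfl⟩
  have cs := card_sumset' hρρ hττ hρ hτ h
  have inj := sum_injOn' hρρ hττ hρ hτ h
  have d₁ := disjoint_sumset₁' hρρ hρτ hτρ hττ hne h
  have d₂ := disjoint_sumset₂' hρρ hρτ hτρ hττ hne h
  have d₃ := disjoint_sumset₃' hρρ hρτ hτρ hττ hne h
  have cX : (sig S₁ T₀ U₀).card = S₁.card * T₀.card * U₀.card := by rw [hsig]; exact cs true false false mS₁ mT₀ mU₀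
  have cY : (sig S₀ T₁ U₀).card = S₀.card * T₁.card * U₀.card := by rw [hsig]; exact cs false true false mS₀ mT₁ mU₀
  have cZ : (sig S₀ T₀ U₁).card = S₀.card * T₀.card * U₁.card := by rw [hsig]; exact cs false false true mS₀ mT₀ mU₁
  have cX' : (sig S₀ T₁ U₁).card = S₀.card * T₁.card * U₁.card := by rw [hsig]; exact cs false true true mS₀ mT₁ mU₁
  have cY' : (sig S₁ T₀ U₁).card = S₁.card * T₀.card * U₁.card := by rw [hsig]; exact cs true false true mS₁ mT₀ mU₁
  have cZ' : (sig S₁ T₁ U₀).card = S₁.card * T₁.card * U₀.card := by rw [hsig]; exact cs true true false mS₁ mT₁ mU₀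
  have fX : ∀ ψ, F (sig S₁ T₀ U₀) ψ = F S₁ ψ * F T₀ ψ * F U₀ ψ := fun ψ => by
    rw [hF, hF, hF, hF, hsig]; exact charsum_sumset' ψ (inj true false false mS₁ mT₀ mU₀)
  have fY : ∀ ψ, F (sig S₀ T₁ U₀) ψ = F S₀ ψ * F T₁ ψ * F U₀ ψ := fun ψ => by
    rw [hF, hF, hF, hF, hsig]; exact charsum_sumset' ψ (inj false true false mS₀ mT₁ mU₀)
  have fZ : ∀ ψ, F (sig S₀ T₀ U₁) ψ = F S₀ ψ * F T₀ ψ * F U₁ ψ := fun ψ => by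
    rw [hF, hF, hF, hF, hsig]; exact charsum_sumset' ψ (inj false false true mS₀ mT₀ mU₁)
  have fX' : ∀ ψ, F (sig S₀ T₁ U₁) ψ = F S₀ ψ * F T₁ ψ * F U₁ ψ := fun ψ => by
    rw [hF, hF, hF, hF, hsig]; exact charsum_sumset' ψ (inj false true true mS₀ mT₁ mU₁)
  have fY' : ∀ ψ, F (sig S₁ T₀ U₁) ψ = F S₁ ψ * F T₀ ψ * F U₁ ψ := fun ψ => by
    rw [hF, hF, hF, hF, hsig]; exact charsum_sumset' ψ (inj true false true mS₁ mT₀ mU₁)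
  have fZ' : ∀ ψ, F (sig S₁ T₁ U₀) ψ = F S₁ ψ * F T₁ ψ * F U₀ ψ := fun ψ => by
    rw [hF, hF, hF, hF, hsig]; exact charsum_sumset' ψ (inj true true false mS₁ mT₁ mU₀)
  have e12 : Disjoint (sig S₁ T₀ U₀) (sig S₀ T₁ U₀) := by rw [hsig, hsig]; exact d₁ false mS₁ mT₀ mU₀ mS₀ mT₁
  have e13 : Disjoint (sig S₁ T₀ U₀) (sig S₀ T₀ U₁) := by
    rw [hsig, hsig]; exact (d₃ false mS₀ mT₀ mU₁ mS₁ mU₀).symm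
  have e23 : Disjoint (sig S₀ T₁ U₀) (sig S₀ T₀ U₁) := by
    rw [hsig, hsig]; exact d₂ false mS₀ mT₁ mU₀ mS₀ mT₀ mU₁
  have e12' : Disjoint (sig S₀ T₁ U₁) (sig S₁ T₀ U₁) := by
    rw [hsig, hsig]; exact (d₁ true mS₁ mT₀ mU₁ mS₀ mT₁).symm
  have e13' : Disjoint (sig S₀ T₁ U₁) (sig S₁ T₁ U₀) := by rw [hsig, hsig]; exact d₃ true mS₀ mT₁ mU₁ mS₁ mU₀
  have e23' : Disjoint (sig S₁ T₀ U₁) (sig S₁ T₁ U₀) := by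
    rw [hsig, hsig]; exact (d₂ true mS₁ mT₁ mU₀ mS₁ mT₀ mU₁).symm
  have tiling : ∀ ψ : AddChar A ℂ, ψ ≠ 0 →
      F S₁ ψ * F T₀ ψ * F U₀ ψ + F S₀ ψ * F T₁ ψ * F U₀ ψ + F S₀ ψ * F T₀ ψ * F U₁ ψ = 0 ∧
      F S₀ ψ * F T₁ ψ * F U₁ ψ + F S₁ ψ * F T₀ ψ * F U₁ ψ + F S₁ ψ * F T₁ ψ * F U₀ ψ = 0 := by
    intro ψ hψ
    constructor
    · have := charsum_tiling' ψ hψ e12 e13 e23 (by rw [cX, cY, cZ]; exact hA₁)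
      rwa [← hF, ← hF, ← hF, fX, fY, fZ] at this
    · have := charsum_tiling' ψ hψ e12' e13' e23' (by rw [cX', cY', cZ']; exact hA₂)
      rwa [← hF, ← hF, ← hF, fX', fY', fZ'] at this
  have hX0 : ∀ X : Finset A, F X 0 = X.card := fun X => by rw [hF]; simp
  have compare : ∀ P Q : Finset A, (∀ ψ : AddChar A ℂ, ψ ≠ 0 → ‖F P ψ‖ = ‖F Q ψ‖) →
      (Fintype.card A : ℝ) * P.card - (P.card : ℝ) ^ 2 = (Fintype.card A : ℝ) * Q.card - (Q.card : ℝ) ^ 2 := by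
    intro P Q hPQ
    have hP := parseval_charsum' P
    have hQ := parseval_charsum' Q
    simp only [← hF] at hP hQ
    have hdiff : ∑ ψ : AddChar A ℂ, (‖F P ψ‖ ^ 2 - ‖F Q ψ‖ ^ 2) = (P.card : ℝ) ^ 2 - (Q.card : ℝ) ^ 2 := by
      rw [Finset.sum_eq_single (0 : AddChar A ℂ)]
      · rw [hX0, hX0]; simp
      · intro ψ _ hψ; rw [hPQ ψ hψ, sub_self]
      · intro h0; exact absurd (mem_univ _) h0
    rw [Finset.sum_sub_distrib] at hdiff
    linarith
  have eXY : (Fintype.card A : ℝ) * (sig S₁ T₀ U₀).card - ((sig S₁ T₀ U₀).card : ℝ) ^ 2 =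
      (Fintype.card A : ℝ) * (sig S₀ T₁ U₀).card - ((sig S₀ T₁ U₀).card : ℝ) ^ 2 := by
    refine compare _ _ fun ψ hψ => ?_
    rw [fX, fY]
    obtain ⟨F1, F2⟩ := tiling ψ hψ
    exact norm_eq_of_tiling_eqs _ _ _ _ _ _ F1 F2
  have eXZ : (Fintype.card A : ℝ) * (sig S₁ T₀ U₀).card - ((sig S₁ T₀ U₀).card : ℝ) ^ 2 =
      (Fintype.card A : ℝ) * (sig S₀ T₀ U₁).card - ((sig S₀ T₀ U₁).card : ℝ) ^ 2 := by
    refine compare _ _ fun ψ hψ => ?_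
    rw [fX, fZ]
    obtain ⟨F1, F2⟩ := tiling ψ hψ
    have F1' : F S₁ ψ * F U₀ ψ * F T₀ ψ + F S₀ ψ * F U₁ ψ * F T₀ ψ + F S₀ ψ * F U₀ ψ * F T₁ ψ = 0 := by
      linear_combination F1
    have F2' : F S₀ ψ * F U₁ ψ * F T₁ ψ + F S₁ ψ * F U₀ ψ * F T₁ ψ + F S₁ ψ * F U₁ ψ * F T₀ ψ = 0 := by
      linear_combination F2
    have := norm_eq_of_tiling_eqs _ _ _ _ _ _ F1' F2'
    rw [show F S₁ ψ * F T₀ ψ * F U₀ ψ = F S₁ ψ * F U₀ ψ * F T₀ ψ by ring,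
      show F S₀ ψ * F T₀ ψ * F U₁ ψ = F S₀ ψ * F U₁ ψ * F T₀ ψ by ring]
    exact this
  rw [cX, cY] at eXY
  rw [cX, cZ] at eXZ
  have pS₀ := card_pos.mpr hs₀; have pS₁ := card_pos.mpr hs₁
  have pT₀ := card_pos.mpr ht₀; have pT₁ := card_pos.mpr ht₁
  have pU₀ := card_pos.mpr hu₀; have pU₁ := card_pos.mpr hu₁
  set N := Fintype.card A
  set X := S₁.card * T₀.card * U₀.card with hXdef
  set Y := S₀.card * T₁.card * U₀.card with hYdef
  set Z := S₀.card * T₀.card * U₁.card with hZdef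
  have hYpos : 0 < Y := by positivity
  have hZpos : 0 < Z := by positivity
  have hsum : X + Y + Z = N := hA₁
  have eXY' : ((X : ℝ) - Y) * Z = 0 := by
    have : (Z : ℝ) = N - X - Y := by
      have := congrArg (fun k : ℕ => (k : ℝ)) hsum; push_cast at this; linarith
    rw [this]; linarith [eXY]
  have eXZ' : ((X : ℝ) - Z) * Y = 0 := by
    have : (Y : ℝ) = N - X - Z := by
      have := congrArg (fun k : ℕ => (k : ℝ)) hsum; push_cast at this; linarith
    rw [this]; linarith [eXZ]
  have hXY : X = Y := by
    rcases mul_eq_zero.mp eXY' with h | h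
    · exact_mod_cast sub_eq_zero.mp h
    · exact absurd (by exact_mod_cast h : Z = 0) hZpos.ne'
  have hXZ : X = Z := by
    rcases mul_eq_zero.mp eXZ' with h | h
    · exact_mod_cast sub_eq_zero.mp h
    · exact absurd (by exact_mod_cast h : Y = 0) hYpos.ne'
  exact ⟨X, by omega⟩

end DihedralLike

end Summit.MatrixMultiplication.OmegaCensus
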